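import Summits.SmoothPoincare4.SmoothPoincare4.Theorems.SullivanDualWitnessChargeHelperUniformLimitLocalise
import Summits.SmoothPoincare4.SmoothPoincare4.Theorems.SullivanDualWitnessChargeFlatChart
import Summits.SmoothPoincare4.SmoothPoincare4.Theorems.SullivanDualWitnessChargeDefs
import Mathlib.Analysis.Complex.Basic
import Mathlib.Topology.UniformSpace.LocallyUniformConvergence

/-!
# Helper `helper_limitConvY` of line `Sketch` for crux `WitnessCharge`
(item stmt-SmoothPoincare4-7824; route `SullivanDual`, crux
`Summit.SmoothPoincare4.SmoothPoincare4.Theses.SullivanDual.WitnessCharge`; line `Sketch`,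
registered stub `helper_limitConvY` of the lead's wave-3 mini-skeleton — (N)-branch, localisation
of the convergence of the extracted subsequence to the flat coordinates of the end)

**Statement.** Let `u (φ k) : ℂ → Σ ∖ p` converge to `G` uniformly on compact sets THROUGH a
continuous injective map `ι : Σ → ℝᴺ` (`ι ∘ u (φ k) → ι ∘ G`), with `G` continuous and
`G ξ` in the punctured `ε'`-chart-ball for `2R < ‖ξ‖`. Then
(a) `u (φ k) ξ → G ξ` in `Σ ∖ p` for every `ξ`, and
(b) the complex flat coordinates converge locally uniformly on the far region:
`Ycoord p (u (φ k) ξ) → Ycoord p (G ξ)` locally uniformly on `V = {ξ | 2R < ‖ξ‖}`.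

**Proof.** (a) `x ↦ ι x.1` is a topological embedding of `Σ ∖ p` into `ℝᴺ` (`ι` is a closed
embedding of the compact Hausdorff `Σ`, composed with the subtype embedding), so convergence may be
tested after applying it (`Topology.IsEmbedding.tendsto_nhds_iff`), where it is the uniform
convergence on the compact set `{ξ}`. (b) By `tendstoLocallyUniformlyOn_iff_forall_isCompact` on
the open set `V` it suffices to prove uniform convergence on every compact `K ⊆ V`. Apply the
landed localisation lemma `helper_uniformLimit_localise` with the open set
`O = (chart source ∩ e ⁻¹' B(e p, ε')) ∖ {p}` (into which `G` maps `K`) and the map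
`F y = ι(e y − e p)` (`e = extChartAt (𝓡 4) p`, `ι = inversion`), continuous on `O` since
`e y ≠ e p` there: this gives uniform convergence of `F ∘ val ∘ u (φ k) = realify ∘ Ycoord p ∘ u (φ k)`
on `K` (`realify_Ycoord`). Finally `Ycoord p = A ∘ realify ∘ Ycoord p` for the continuous linear
(hence uniformly continuous) left inverse `A` of `realify` (`exists_coordCLM`), and uniform
convergence is preserved under `A` (`UniformContinuous.comp_tendstoUniformlyOn`).
-/

noncomputable section

-- the registered namespace `Summit.SmoothPoincare4.SmoothPoincare4.…` repeats a component
set_option linter.dupNamespace false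

open scoped Manifold ContDiff Topology
open Set Filter Literature.Geometry.Kaehler Literature.Geometry.Symplectic
  Literature.Topology.FourManifolds

namespace Summit.SmoothPoincare4.SmoothPoincare4.Theorems.WitnessCharge.PencilIncompleteness

/-- For a continuous injective `ι : Σ → ℝᴺ` on the compact Hausdorff manifold `Σ`, the map
`x ↦ ι x.1` is a topological embedding of the punctured manifold `Σ ∖ p` into `ℝᴺ`. -/
theorem limitConvY_isEmbedding_val {S : HomotopySphere 4} (p : S.carrier) {N : ℕ}
    {ι : S.carrier → EuclideanSpace ℝ (Fin N)} (hι : Continuous ι) (hιinj : Function.Injective ι) :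
    Topology.IsEmbedding (fun x : punctured p => ι x.1) :=
  (hι.isClosedEmbedding hιinj).isEmbedding.comp Topology.IsEmbedding.subtypeVal

/-- The set `O = (chart source ∩ e ⁻¹' B(e p, ε')) ∖ {p}` of points of `Σ` whose lift to `Σ ∖ p`
lies in the punctured `ε'`-chart-ball is open. -/
theorem limitConvY_isOpen_chartSet {S : HomotopySphere 4} (p : S.carrier) (ε' : ℝ) :
    IsOpen (((chartAt (EuclideanSpace ℝ (Fin 4)) p).source ∩
      extChartAt (𝓡 4) p ⁻¹' Metric.ball (extChartAt (𝓡 4) p p) ε') ∩ {p}ᶜ) :=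
  (isOpen_extChartAt_preimage (I := 𝓡 4) p Metric.isOpen_ball).inter isOpen_compl_singleton

/-- The flat coordinate map `y ↦ ι(e y − e p)` is continuous on
`O = (chart source ∩ e ⁻¹' B(e p, ε')) ∖ {p}`: the chart is continuous on its source, `e y ≠ e p`
for `y ∈ O` (injectivity of the chart on its source), and `ι` is smooth away from `0`. -/
theorem limitConvY_continuousOn_inversion {S : HomotopySphere 4} (p : S.carrier) (ε' : ℝ) :
    ContinuousOn
      (fun y : S.carrier => inversion (extChartAt (𝓡 4) p y - extChartAt (𝓡 4) p p))
      (((chartAt (EuclideanSpace ℝ (Fin 4)) p).source ∩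
        extChartAt (𝓡 4) p ⁻¹' Metric.ball (extChartAt (𝓡 4) p p) ε') ∩ {p}ᶜ) := by
  intro y hy
  have hne : extChartAt (𝓡 4) p y - extChartAt (𝓡 4) p p ≠ 0 :=
    sub_ne_zero_of_ball (ε' := ε') (x := ⟨y, mem_punctured.2 hy.2⟩) hy.1
  have hy' : y ∈ (extChartAt (𝓡 4) p).source := by
    rw [extChartAt_source]
    exact hy.1.1
  have h2 : ContinuousAt
      (fun y' : S.carrier => extChartAt (𝓡 4) p y' - extChartAt (𝓡 4) p p) y :=
    (continuousAt_extChartAt' hy').fun_sub continuousAt_const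
  exact (ContinuousAt.comp (g := inversion)
    (f := fun y' : S.carrier => extChartAt (𝓡 4) p y' - extChartAt (𝓡 4) p p) (x := y)
    (contDiffAt_inversion (n := 0) hne).continuousAt h2).continuousWithinAt

/-- The complex flat coordinates are recovered from the real flat coordinate `ι(e x − e p)` by the
continuous linear left inverse `A` of `realify`: `Ycoord p x = A (ι(e x − e p))`. -/
theorem limitConvY_Ycoord_eq {S : HomotopySphere 4} (p : S.carrier)
    {A : EuclideanSpace ℝ (Fin 4) →L[ℝ] ℂ × ℂ}
    (hA : ∀ y : EuclideanSpace ℝ (Fin 4), realify (A y) = y) (x : punctured p) :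
    Ycoord p x = A (inversion (extChartAt (𝓡 4) p x.1 - extChartAt (𝓡 4) p p)) := by
  rw [← realify_Ycoord]
  exact (realify_injective (hA (realify (Ycoord p x)))).symm

/-- **W3-7 (`helper_limitConvY`): pointwise convergence on the manifold and locally uniform
convergence of the flat coordinates on the far region, from uniform convergence through the
injection `ι : Σ → ℝᴺ`.** If `ι ∘ u (φ k) → ι ∘ G` uniformly on compact subsets of `ℂ` for a
continuous injective `ι`, `G` continuous, and `G ξ` lies in the punctured `ε'`-chart-ball whenever
`2R < ‖ξ‖`, then (a) `u (φ k) ξ → G ξ` for every `ξ` (test convergence after the embedding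
`x ↦ ι x.1`), and (b) `Ycoord p (u (φ k) ·) → Ycoord p (G ·)` locally uniformly on `{2R < ‖ξ‖}`
(uniform convergence on each compact `K`: localise through `ι` to the chart ball with
`helper_uniformLimit_localise` and the map `y ↦ ι(e y − e p) = realify (Ycoord p ·)`, then apply the
uniformly continuous linear left inverse of `realify`). -/
theorem helper_limitConvY :
    ∀ (S : HomotopySphere 4) (p : S.carrier) (ε' : ℝ), 0 < ε' →
      ∀ (N : ℕ) (ι : S.carrier → EuclideanSpace ℝ (Fin N)),
        Continuous ι → Function.Injective ι →
      ∀ (u : ℕ → ℂ → punctured p) (G : ℂ → punctured p) (φ : ℕ → ℕ),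
        (∀ n, Continuous (u n)) → Continuous G →
        (∀ D : Set ℂ, IsCompact D →
          TendstoUniformlyOn (fun k ζ => ι (u (φ k) ζ).1) (fun ζ => ι (G ζ).1) atTop D) →
        ∀ R : ℝ, (∀ ξ : ℂ, 2 * R < ‖ξ‖ → InPuncturedChartBall p ε' (G ξ)) →
          (∀ ξ : ℂ, Tendsto (fun k => u (φ k) ξ) atTop (𝓝 (G ξ))) ∧
          TendstoLocallyUniformlyOn (fun k ξ => Ycoord p (u (φ k) ξ)) (fun ξ => Ycoord p (G ξ))
            atTop {ξ : ℂ | 2 * R < ‖ξ‖} := by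
  intro S p ε' _hε' N ι hι hιinj u G φ _hu hG hunif R hGfar
  refine ⟨fun ξ => (limitConvY_isEmbedding_val p hι hιinj).tendsto_nhds_iff.2
    ((hunif {ξ} isCompact_singleton).tendsto_at (mem_singleton ξ)), ?_⟩
  -- (b): uniform convergence on every compact `K ⊆ V`, `V = {2R < ‖ξ‖}` open
  have hV : IsOpen {ξ : ℂ | 2 * R < ‖ξ‖} := isOpen_lt continuous_const continuous_norm
  rw [tendstoLocallyUniformlyOn_iff_forall_isCompact hV]
  intro K hKV hK
  -- the continuous linear left inverse `A` of `realify`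
  obtain ⟨A, -, hA⟩ := exists_coordCLM
  -- `G` maps `K` into the open set `O = (chart source ∩ e ⁻¹' B(e p, ε')) ∖ {p}`
  have hmaps : MapsTo (fun z : ℂ => (G z).1) K
      (((chartAt (EuclideanSpace ℝ (Fin 4)) p).source ∩
        extChartAt (𝓡 4) p ⁻¹' Metric.ball (extChartAt (𝓡 4) p p) ε') ∩ {p}ᶜ) :=
    fun z hz => ⟨hGfar z (hKV hz), mem_punctured.1 (G z).2⟩
  -- localise the uniform convergence through `ι` to the chart ball and compose with `ι(e · − e p)`
  obtain ⟨-, hF⟩ := helper_uniformLimit_localise S.carrier N ι hι hιinj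
    (fun j z => (u (φ j) z).1) (fun z => (G z).1) K hK (hunif K hK)
    (continuous_subtype_val.comp hG).continuousOn _ (limitConvY_isOpen_chartSet p ε') hmaps
  have h1 := hF _ (limitConvY_continuousOn_inversion p ε')
  -- apply the uniformly continuous left inverse `A` of `realify`
  have h2 := A.uniformContinuous.comp_tendstoUniformlyOn h1
  simpa only [Function.comp_def, limitConvY_Ycoord_eq p hA] using h2

end Summit.SmoothPoincare4.SmoothPoincare4.Theorems.WitnessCharge.PencilIncompleteness
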